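import Summits.HodgeConjecture.HodgeConjecture.Theorems.LinearSystemTorelliLocalTubeSpanTypedBasis
import Summits.HodgeConjecture.HodgeConjecture.Theorems.LinearSystemTorelliLocalTubeSpanTypedInstances

/-!
# Route LinearSystemTorelli — crux `LocalTubeSpan` (stmt-HodgeConjecture-2490): the non-isolated member along a neighbourhood basis (capstone, complete orbit)

Helper file (`--supports stmt-HodgeConjecture-2490`, line `Sketch` of the crux chain, cycle 6,
continuation lead c5; composition).

Companion of `…Capstone` (NC-nodal member along a basis, unconditionally): the typed crux in colimit
form at a point `t₀` whose local configuration is ONE COMPLETE ORBIT — the non-isolated members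
`Y₁ ∪ Y₂` of the refuters' residual stratum — stated along a neighbourhood BASIS (the sound shape of
cycle 6, `…TypedBasis`), granting Schnell's Lemma 11 (after cycle 6: equivalently its nondegenerate
case, `…Lemma11OfNondegenerate`; equivalently Janssen's Theorems 2.5 + 2.9, `…Lemma11Nondegenerate`):

* `localTubeSpan_cfree_at_of_completeOrbitBasis` — for the direct-image local system of a smooth
  projective family, if along a basis of `𝓝 t₀` every basic set has path-connected punctured
  preimage and ONE local subgroup presented by a complete orbit (generators acting on
  `Hᵏ(X_s(ℂ); ℚ)` through the rational monodromy as transvections along a realised, finitely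
  generated, integral, stable single orbit `Δ` with a pair `⟨δ₁, δ₂⟩ = 1`), then every class
  undetected near `t₀` lies in `localKernel ι (D.V k) s t₀`.

Named fact: `Schnell2010_lemma11` (hypothesis); no `sorry`.
-/

-- `Summit.HodgeConjecture.HodgeConjecture.Theorems` is the mandated namespace (single-conjunct summit:
-- Sub = Summit), which `linter.dupNamespace` flags on every declaration; the lakefile turns the
-- linter off tree-wide (weak option), restated here so stand-alone elaboration is warning-free too.
set_option linter.dupNamespace false

noncomputable section

open CategoryTheory groupCohomology
open _root_.Topology Filter
open Literature.AlgebraicGeometry Literature.AlgebraicGeometry.HodgeTheory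
open Literature.AlgebraicTopology.SingularHomology

namespace Summit.HodgeConjecture.HodgeConjecture.Theorems

universe v

variable {𝒳 Sb : Motives.SchemeOver ℂ} {π : 𝒳 ⟶ Sb} {n : ℕ} {T : Type v} [TopologicalSpace T]

/-- **The one-complete-orbit member along a neighbourhood basis (full carrier), granting Schnell's
Lemma 11.**  For the direct-image local system `Rᵏ π_* ℂ|_U` of a smooth projective family, a base
point `s`, a continuous `ι : U → T` and a basis `(bs i)_{p i}` of `𝓝 t₀` such that every basic set
has path-connected `ι⁻¹ (bs i)` and ONE local subgroup `S = localSubgroup ι s (bs i) hs' γ`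
presented by a complete orbit — a generating set `gen ⊆ S` acting on `Hᵏ(X_s(ℂ); ℚ)` through the
rational monodromy as transvections of an alternating form `B` along members of a set `Δ` of cycles
which is realised in `S`, finitely generated over `ℤ`, integral, `S`-stable, a single `S`-orbit, and
contains a pair with `⟨δ₁, δ₂⟩ = 1` (the local vanishing configuration at a two-component member
`Y₁ ∪ Y₂`: one branch of the local discriminant, a cusp of the dual variety of `Y₁ ∩ Y₂`): every
class undetected on the local subgroups of some neighbourhood of `t₀` lies in
`localKernel ι (D.V k) s t₀` — the colimit form of the crux at `t₀`
(`localTubeSpan_injective_evalCoinv_res_rat_of_completeOrbit` per basic set +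
`localTubeSpan_mem_localKernel_of_rat_hasBasis_one`).
[cite: Schnell2010, §7 Prop. 12 and Lemma 11] -/
theorem localTubeSpan_cfree_at_of_completeOrbitBasis (hL11 : Schnell2010_lemma11)
    (ι : C(smoothFiberLocus π n, T)) (D : DirectImageLocalSystem π n) (k : ℕ)
    (s : smoothFiberLocus π n) {ι' : Sort*} {p : ι' → Prop} {bs : ι' → Set T} {t₀ : T}
    (hbs : (𝓝 t₀).HasBasis p bs)
    (horb : ∀ i, p i → IsPathConnected (ι ⁻¹' bs i) ∧
      ∃ (s' : smoothFiberLocus π n) (hs' : ι s' ∈ bs i) (γ : Path s' s)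
        (B : LinearMap.BilinForm ℚ (Motives.bettiCohomology (Motives.fiberOver π s.1) k))
        (Δ : Set (Motives.bettiCohomology (Motives.fiberOver π s.1) k))
        (gen : Set (localSubgroup ι s (bs i) hs' γ)),
        B.IsAlt ∧ Subgroup.closure gen = ⊤ ∧
        (∀ t ∈ gen, ∃ δ ∈ Δ, ∀ x,
          D.ratMonodromy k s (t : FundamentalGroup (smoothFiberLocus π n) s) x = x - B x δ • δ) ∧
        (∀ δ ∈ Δ, ∃ g : localSubgroup ι s (bs i) hs' γ, ∀ x,
          D.ratMonodromy k s (g : FundamentalGroup (smoothFiberLocus π n) s) x = x - B x δ • δ) ∧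
        (Submodule.span ℤ Δ).FG ∧ (∀ δ ∈ Δ, ∀ δ' ∈ Δ, ∃ z : ℤ, B δ δ' = z) ∧
        (∀ (g : localSubgroup ι s (bs i) hs' γ), ∀ δ ∈ Δ,
          D.ratMonodromy k s (g : FundamentalGroup (smoothFiberLocus π n) s) δ ∈ Δ) ∧
        (∀ δ ∈ Δ, ∀ δ' ∈ Δ, ∃ g : localSubgroup ι s (bs i) hs' γ,
          D.ratMonodromy k s (g : FundamentalGroup (smoothFiberLocus π n) s) δ = δ') ∧
        (∃ δ₁ ∈ Δ, ∃ δ₂ ∈ Δ, B δ₁ δ₂ = 1))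
    (ξ : groupCohomology.H1 (monodromyRepObj (D.V k) s))
    (hξ : ∃ N ∈ 𝓝 t₀, ∀ (s' : smoothFiberLocus π n) (hs' : ι s' ∈ N) (γ : Path s' s),
      evalCoinvOn (monodromyRepObj (D.V k) s) (localSubgroup ι s N hs' γ) ξ = 0) :
    ξ ∈ localKernel ι (D.V k) s t₀ := by
  refine localTubeSpan_mem_localKernel_of_rat_hasBasis_one ι D k s hbs (fun i hi => ?_) ξ hξ
  obtain ⟨hpc, s', hs', γ, B, Δ, gen, hB, hgen, hgenΔ, hΔS, hfg, hint, hstable, htrans, hpair⟩ :=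
    horb i hi
  exact ⟨hpc, s', hs', γ, localTubeSpan_injective_evalCoinv_res_rat_of_completeOrbit hL11 D k s _ B hB
    Δ gen hgen hgenΔ hΔS hfg hint hstable htrans hpair⟩

end Summit.HodgeConjecture.HodgeConjecture.Theorems

end
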